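import Mathlib
import HarnessLib
import Summits.HubbardSuperconductivity.HubbardSuperconductivity.Theorems.KLProgrammeKLRegimeEngineTowerLevNumericsBase

/-!
# Route `KLProgramme` — crux K3 ENGINE (stmt-HubbardSuperconductivity-20437 `KLRegimeEngineV17F2`), stub (b) v2, THE LEVELS PACKAGE (ℓ), numerics side
# «(ℓ)-NUMERICS» part 3a-C (cell gate-hubbard-kl, seat p4 g21): THE BASE DATUM ON SHAPES WITH THE TWO-TERM FRAME WEIGHT («(ℓ)-FRAME-WEIGHT-SHAPE», p1b g17)

`levNum_base_reduce` (…NumericsBase) took the frame weight `Σ_z‖framePosKernel K_n z‖(1+|z|) ≤ f₀·U`; what `FrameOK` delivers in the KL regime is the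
TWO-TERM shape `≤ klE4KapF R·|U| + 2(c/log 4)·klE4Mom R` (`frameKernel_weightedL1_le`, `kKbar_le`, `nScales_succ_mul_sq_le` — …ScaleZeroE4PackageParts/Doors):
a U-term AND a c-term.  **`levNum_base_reduceC`** is the same reduction with `F ≤ fU·U + fC·c` and TWO doors `U ≤ 1/(4θU+1)`, `c ≤ 1/(4θc+1)`
(`θU·U ≤ 1/4`, `θc·c ≤ 1/4`): conclusions unchanged — `e·αw·nV/κ² ≤ 1/2`, `cg = g₀`, `Ag = A₀·(β/M)`, `P₀(M/β)² ≤ Pg ≤ 2P₀(M/β)²`.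
Pure real arithmetic; nothing about the model is asserted; nothing asserts (ℓ), any stub, K3 or superconductivity.
References: BGM 2006 §2.8 (2.77)–(2.80), (2.93)–(2.98) [cite: BenfattoGiulianiMastropietro2006].
-/

noncomputable section

namespace Summit.HubbardSuperconductivity.HubbardSuperconductivity.Theorems.EngineV8

set_option linter.dupNamespace false -- summit = problem name (single-conjunct summit), D-0017

open Real Finset Literature.MathematicalPhysics.QuantumLattice

/-! ## §1 The base datum on shapes, two-term frame weight -/

/-- **THE BASE DATUM ON SHAPES, TWO-TERM FRAME WEIGHT.**  With `κ = κ₀ > 0`, `ρ = ρ₀ > 0`, `αw = a₀·(M/β)`, `crw = r₀·(M/β)`, `ccw = w₀·(M/β)` (`a₀, r₀, w₀ > 0`), a field-weighted norm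
`0 ≤ nV ≤ (e²(κ+ρ))²·(|β|/(4M))·F + (e²(κ+ρ))⁴·(|U|·|β|/(4M))` with the TWO-TERM frame weight `F ≤ fU·U + fC·c` («(ℓ)-FRAME-WEIGHT-SHAPE»: the Jackson
pieces' first moment is `∝ (n_β+1)U² ≤ c/log 4`, `frameKernel_weightedL1_le` ∘ `kKbar_le`) and the two doors `0 < U ≤ 1/(4θU+1)`, `0 ≤ c ≤ 1/(4θc+1)`
(`θU = (e·a₀/(4κ₀²))·((e²(κ₀+ρ₀))²fU + (e²(κ₀+ρ₀))⁴)`, `θc = (e·a₀/(4κ₀²))·(e²(κ₀+ρ₀))²fC`), the assembly's `cF cg Ag Pg` binders give: `e·αw·nV/κ² ≤ 1/2`,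
`cg = g₀`, `Ag = A₀·(β/M)`, `P₀·(M/β)² ≤ Pg ≤ 2P₀·(M/β)²`. [cite: BenfattoGiulianiMastropietro2006, §2.8 (2.77)-(2.80)] -/
theorem levNum_base_reduceC {β U c κ ρ αw crw ccw nV cF cg Ag Pg F κ₀ ρ₀ a₀ r₀ w₀ fU fC θU θc g₀ A₀ P₀ : ℝ} {M : ℕ} [NeZero M]
    (hβ : 0 < β) (hκ₀ : 0 < κ₀) (hρ₀ : 0 < ρ₀) (ha₀ : 0 < a₀) (hr₀ : 0 < r₀) (hw₀ : 0 < w₀) (hfU : 0 ≤ fU) (hfC : 0 ≤ fC)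
    (hθU : θU = exp 1 * a₀ / (4 * κ₀ ^ 2) * ((exp 2 * (κ₀ + ρ₀)) ^ 2 * fU + (exp 2 * (κ₀ + ρ₀)) ^ 4))
    (hθc : θc = exp 1 * a₀ / (4 * κ₀ ^ 2) * ((exp 2 * (κ₀ + ρ₀)) ^ 2 * fC))
    (hg₀ : g₀ = exp 1 * a₀ * (exp 2 * (κ₀ + ρ₀)) ^ 4 / (4 * κ₀ ^ 2)) (hA₀ : A₀ = exp 1 * r₀ * (exp 2 * (κ₀ + ρ₀)) ^ 4 / (4 * w₀ * g₀ ^ 2))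
    (hP₀ : P₀ = w₀ ^ 2 * g₀ / ρ₀ ^ 2)
    (hU : 0 < U) (hUθ : U ≤ 1 / (4 * θU + 1)) (hc : 0 ≤ c) (hcθ : c ≤ 1 / (4 * θc + 1)) (hF : F ≤ fU * U + fC * c)
    (hκ : κ = κ₀) (hρ : ρ = ρ₀) (hαw : αw = a₀ * ((M : ℝ) / β)) (hcrw : crw = r₀ * ((M : ℝ) / β)) (hccw : ccw = w₀ * ((M : ℝ) / β))
    (hnV0 : 0 ≤ nV) (hnV : nV ≤ (exp 2 * (κ + ρ)) ^ 2 * (|β| / (2 * (2 * M) : ℕ) * F) + (exp 2 * (κ + ρ)) ^ 4 * (|U| * |β| / (2 * (2 * M) : ℕ)))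
    (hcF : cF = (exp 2 * (κ + ρ)) ^ (2 * 2) * (|β| / (2 * (2 * M) : ℕ))) (hcg : cg = exp 1 * αw * cF / κ ^ 2)
    (hAg : Ag = crw * exp 1 * cF / (ccw * cg ^ 2)) (hPg : Pg = ccw ^ 2 * cg / (ρ ^ 2 * (1 - exp 1 * αw * nV / κ ^ 2))) :
    exp 1 * αw * nV / κ ^ 2 ≤ 1 / 2 ∧ cg = g₀ ∧ Ag = A₀ * (β / M) ∧ P₀ * ((M : ℝ) / β) ^ 2 ≤ Pg ∧ Pg ≤ 2 * P₀ * ((M : ℝ) / β) ^ 2 := by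
  have hM : (0 : ℝ) < M := Nat.cast_pos.2 (Nat.pos_of_ne_zero (NeZero.ne M))
  have hcast : ((2 * (2 * M) : ℕ) : ℝ) = 4 * M := by push_cast; ring
  have hβabs : |β| = β := abs_of_pos hβ
  have hUabs : |U| = U := abs_of_pos hU
  subst κ ρ
  rw [hcast, hβabs, hUabs] at hnV
  rw [hcast, hβabs] at hcF
  have hc0 : 0 < exp 2 * (κ₀ + ρ₀) := by positivity
  have hg₀0 : 0 < g₀ := by rw [hg₀]; positivity
  -- θ
  have hθU0 : 0 ≤ θU := by rw [hθU]; positivity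
  have hθc0 : 0 ≤ θc := by rw [hθc]; positivity
  have hFc0 : 0 ≤ fU * U + fC * c := by positivity
  have hθ : exp 1 * αw * nV / κ₀ ^ 2 ≤ 1 / 2 := by
    have h1 : exp 1 * αw * nV / κ₀ ^ 2 ≤ θU * U + θc * c := by
      rw [hαw, hθU, hθc, div_le_iff₀ (by positivity)]
      have hnV' : nV ≤ (exp 2 * (κ₀ + ρ₀)) ^ 2 * (β / (4 * M) * (fU * U + fC * c)) + (exp 2 * (κ₀ + ρ₀)) ^ 4 * (U * β / (4 * M)) :=
        hnV.trans (by gcongr)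
      calc exp 1 * (a₀ * ((M : ℝ) / β)) * nV ≤ exp 1 * (a₀ * ((M : ℝ) / β)) *
            ((exp 2 * (κ₀ + ρ₀)) ^ 2 * (β / (4 * M) * (fU * U + fC * c)) + (exp 2 * (κ₀ + ρ₀)) ^ 4 * (U * β / (4 * M))) := by gcongr
        _ = (exp 1 * a₀ / (4 * κ₀ ^ 2) * ((exp 2 * (κ₀ + ρ₀)) ^ 2 * fU + (exp 2 * (κ₀ + ρ₀)) ^ 4) * U +
              exp 1 * a₀ / (4 * κ₀ ^ 2) * ((exp 2 * (κ₀ + ρ₀)) ^ 2 * fC) * c) * κ₀ ^ 2 := by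
            field_simp; ring
    have h2 : θU * U ≤ 1 / 4 := by
      calc θU * U ≤ θU * (1 / (4 * θU + 1)) := by gcongr
        _ ≤ 1 / 4 := by rw [mul_one_div, div_le_iff₀ (by positivity)]; linarith
    have h3 : θc * c ≤ 1 / 4 := by
      calc θc * c ≤ θc * (1 / (4 * θc + 1)) := by gcongr
        _ ≤ 1 / 4 := by rw [mul_one_div, div_le_iff₀ (by positivity)]; linarith
    linarith
  have hθ0 : 0 ≤ exp 1 * αw * nV / κ₀ ^ 2 := by rw [hαw]; positivity
  -- cg, Ag
  have hcg' : cg = g₀ := by rw [hcg, hcF, hαw, hg₀]; field_simp; ring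
  have hAg' : Ag = A₀ * (β / M) := by
    rw [hAg, hcrw, hccw, hcg', hcF, hA₀]; field_simp; ring
  -- Pg two-sided
  have hden₁ : (1 : ℝ) / 2 ≤ 1 - exp 1 * αw * nV / κ₀ ^ 2 := by linarith
  have hden₂ : 1 - exp 1 * αw * nV / κ₀ ^ 2 ≤ 1 := by linarith
  have hPg' : Pg = P₀ * ((M : ℝ) / β) ^ 2 / (1 - exp 1 * αw * nV / κ₀ ^ 2) := by
    rw [hPg, hccw, hcg', hP₀]; field_simp
  have hP₀0 : 0 < P₀ * ((M : ℝ) / β) ^ 2 := by rw [hP₀]; positivity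
  refine ⟨hθ, hcg', hAg', ?_, ?_⟩
  · rw [hPg']; exact le_div_self hP₀0.le (by linarith) hden₂
  · rw [hPg', div_le_iff₀ (by linarith)]
    have h := mul_le_mul_of_nonneg_left hden₁ hP₀0.le
    linarith

end Summit.HubbardSuperconductivity.HubbardSuperconductivity.Theorems.EngineV8

end
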